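import Summits.QuantumFields.YangMills.Theorems.LangevinControlUVOSLegsAtWeakCouplingCSketchSplit
import Summits.QuantumFields.YangMills.Theorems.LangevinControlUVOSLegsFromFemtoAndGapStubCollar6
import Summits.QuantumFields.YangMills.Theorems.LangevinControlUVOSLegsAtWeakCouplingCFblOfFbl6
import Summits.QuantumFields.YangMills.Theorems.LangevinControlUVOSLegsAtWeakCouplingCStubLowerI
import Summits.QuantumFields.YangMills.Theorems.LangevinControlUVOSLegsAtWeakCouplingCStubInherit
import HarnessLib

/-!
# Crux `OSLegsAtWeakCouplingC` (stmt-QuantumFields-16207), line `inherited-amplitude-gates`: the def-free glue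
# from the five ENGINE statements to the crux

With the two provable stubs of the line LANDED (`stub_inherit`, p168865; `stub_lowerI`, p164159), the skeleton
`Cruxes/OSLegsAtWeakCouplingC/Lines/inherited_amplitude_gates.lean` (v3) is sorry-free modulo its five engine-grade stubs.
This file records that reduction as kernel-checked, def-free implications in route vocabulary (pattern of
`Sketch.osLegsAtWeakCouplingC_of_subs`, p140922), so that a planner can file the engine statements as items and close
the crux by modus ponens:

* `largeTorusNonTrivialityC_of_engine` — the line's thesis: the NT leg (`LowerBounds`, ⇔ candidate child
  `LargeTorusNonTrivialityC`) follows from the four FEMTO engine statements `stub_boundaryLaw` (FBL6), `stub_gates`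
  (η-relative gates `GateAxis ∧ GateD`), `stub_tame` (`FlatShape2 ∧ FitWindow`), `stub_skewFloor` (FC3) — through the landed
  `stub_inherit` (inheritance of the absolute two-point amplitude from H1) and `stub_lowerI`;
* `uvHyperscalingC_of_boundaryLaw` — the E0′ leg (`MomentBounds6`, ⇔ `UVHyperscalingC`) from `stub_boundaryLaw` alone
  (landed `stub_collar6`);
* `osLegsAtWeakCouplingC_of_engine` — the crux from the five statements (the fifth being E1C verbatim), by the landed
  `Sketch.osLegsAtWeakCouplingC_of_legs`.

Hypotheses are VERBATIM the registered stub signatures of the skeleton (so `--glue-by` type-checks against items filed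
from them).  Nothing is asserted.
-/

set_option autoImplicit false

noncomputable section

open scoped SchwartzMap BigOperators
open MeasureTheory Filter Topology
open Literature.MathematicalPhysics.QuantumFieldTheory Literature.MathematicalPhysics.QuantumLattice
open Literature.MathematicalPhysics.AQFT Literature.Probability.LatticeModels
open Summit.QuantumFields.YangMills.Theses.LangevinControlUV (OSLegsAtWeakCouplingC)
open Summit.QuantumFields.YangMills.Cruxes.OSLegsFromFemtoAndGap.DlrCollarTransfer
open Summit.QuantumFields.YangMills.Cruxes.OSLegsAtWeakCouplingC.Sketch
  (osLegsAtWeakCouplingC_of_legs uvHyperscalingC_pointwise_iff latticeWard_of_latticeWardGermC_pointwise)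

namespace Summit.QuantumFields.YangMills.Cruxes.OSLegsAtWeakCouplingC.InheritedAmplitudeGates

/-- **The NT leg from the four femto engine statements** (registered sub-goal `largeTorusNonTrivialityC_of_engine` of
crux stmt-QuantumFields-16207, line `inherited-amplitude-gates`): FBL6, the η-relative gates, the flat-box shape fact +
open-window fit, and the signed conditional third cumulant FC3 — each for every `(G, r, a)` carrying the crux
hypotheses — give `LowerBounds G r a` at every such `(G, r, a)`, through the LANDED `stub_inherit` (H1 pins the
absolute amplitude: `FC2I`) and `stub_lowerI` (`FBL ∧ FC2I ∧ FC3 ⟹ LowerBounds`). [folklore] -/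
theorem largeTorusNonTrivialityC_of_engine : (∀ (G : Type) [Group G] [TopologicalSpace G] [IsTopologicalGroup G] [CompactSpace G] [MeasurableSpace G] [BorelSpace G], IsCompactSimpleLieGroup G → ∀ (r : LatticeRep G) (a : ℝ → ℝ), Continuous a → TwoPoint G r a → Skewness G r a → GapInUnits G r a → FBL6 G r a) → (∀ (G : Type) [Group G] [TopologicalSpace G] [IsTopologicalGroup G] [CompactSpace G] [MeasurableSpace G] [BorelSpace G], IsCompactSimpleLieGroup G → ∀ (r : LatticeRep G) (a : ℝ → ℝ), Continuous a → TwoPoint G r a → Skewness G r a → GapInUnits G r a → GateAxis G r a ∧ GateD G r a) → (∀ (G : Type) [Group G] [TopologicalSpace G] [IsTopologicalGroup G] [CompactSpace G] [MeasurableSpace G] [BorelSpace G], IsCompactSimpleLieGroup G → ∀ (r : LatticeRep G) (a : ℝ → ℝ), Continuous a → TwoPoint G r a → Skewness G r a → GapInUnits G r a → FlatShape2 G r a ∧ FitWindow G r a) → (∀ (G : Type) [Group G] [TopologicalSpace G] [IsTopologicalGroup G] [CompactSpace G] [MeasurableSpace G] [BorelSpace G], IsCompactSimpleLieGroup G → ∀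 (r : LatticeRep G) (a : ℝ → ℝ), Continuous a → TwoPoint G r a → Skewness G r a → GapInUnits G r a → FC3 G r a) → ∀ (G : Type) [Group G] [TopologicalSpace G] [IsTopologicalGroup G] [CompactSpace G] [MeasurableSpace G] [BorelSpace G], IsCompactSimpleLieGroup G → ∀ (r : LatticeRep G) (a : ℝ → ℝ), Continuous a → TwoPoint G r a → Skewness G r a → GapInUnits G r a → LowerBounds G r a := by
  intro hBL hGates hTame hK3 G _ _ _ _ _ _ hG r a ha h1 h2 h3
  have hFBL6 : FBL6 G r a := hBL G hG r a ha h1 h2 h3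
  obtain ⟨hGA, hGD⟩ := hGates G hG r a ha h1 h2 h3
  obtain ⟨hFS, hFit⟩ := hTame G hG r a ha h1 h2 h3
  have hFC2I : FC2I G r a := stub_inherit G hG r a ha h1 hFit hFBL6 hGA hGD hFS
  have hFC3 : FC3 G r a := hK3 G hG r a ha h1 h2 h3
  obtain ⟨Γ, β₀, ℓ₀, c, C, -, -, hpos, hlim, -⟩ := h1
  exact stub_lowerI G r a hpos hlim (fbl_of_fbl6 r a hFBL6) hFC2I hFC3

/-- **The E0′ leg from the femto boundary law** (`stub_collar6`, landed): `stub_boundaryLaw`'s statement gives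
`MomentBounds6 G r a` (⇔ candidate child `UVHyperscalingC`) at every `(G, r, a)` carrying the crux hypotheses. [folklore] -/
theorem uvHyperscalingC_of_boundaryLaw : (∀ (G : Type) [Group G] [TopologicalSpace G] [IsTopologicalGroup G] [CompactSpace G] [MeasurableSpace G] [BorelSpace G], IsCompactSimpleLieGroup G → ∀ (r : LatticeRep G) (a : ℝ → ℝ), Continuous a → TwoPoint G r a → Skewness G r a → GapInUnits G r a → FBL6 G r a) →
    ∀ (G : Type) [Group G] [TopologicalSpace G] [IsTopologicalGroup G] [CompactSpace G] [MeasurableSpace G] [BorelSpace G],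
      IsCompactSimpleLieGroup G → ∀ (r : LatticeRep G) (a : ℝ → ℝ), Continuous a → TwoPoint G r a → Skewness G r a →
        GapInUnits G r a → MomentBounds6 G r a := by
  intro hBL G _ _ _ _ _ _ hG r a ha h1 h2 h3
  exact stub_collar6 G r a (hBL G hG r a ha h1 h2 h3)

/-- **The crux from the five engine statements of line `inherited-amplitude-gates`** (def-free glue for a planner
`--split … --glue-by`): `stub_boundaryLaw` (FBL6) → `stub_gates` (GateAxis ∧ GateD) → `stub_tame` (FlatShape2 ∧ FitWindow)
→ `stub_skewFloor` (FC3) → `stub_latticeWardGerm` (E1C verbatim = candidate child `LatticeWardGermC`) →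
`OSLegsAtWeakCouplingC`; E0′ by `uvHyperscalingC_of_boundaryLaw`, NT by `largeTorusNonTrivialityC_of_engine`, E1 by the
landed bridge `latticeWard_of_latticeWardGermC_pointwise`, glued by `osLegsAtWeakCouplingC_of_legs` (p140922). [folklore] -/
theorem osLegsAtWeakCouplingC_of_engine : (∀ (G : Type) [Group G] [TopologicalSpace G] [IsTopologicalGroup G] [CompactSpace G] [MeasurableSpace G] [BorelSpace G], IsCompactSimpleLieGroup G → ∀ (r : LatticeRep G) (a : ℝ → ℝ), Continuous a → TwoPoint G r a → Skewness G r a → GapInUnits G r a → FBL6 G r a) → (∀ (G : Type) [Group G] [TopologicalSpace G] [IsTopologicalGroup G] [CompactSpace G] [MeasurableSpace G] [BorelSpace G], IsCompactSimpleLieGroup G → ∀ (r : LatticeRep G) (a : ℝ → ℝ), Continuous a → TwoPoint G r a → Skewness G r a → GapInUnits G r a → GateAxis G r a ∧ GateD G r a) → (∀ (G : Type) [Group G] [TopologicalSpace G] [IsTopologicalGroup G] [CompactSpace G] [MeasurableSpace G] [BorelSpace G], IsCompactSimpleLieGroup G → ∀ (r : LatticeRep G) (a : ℝ → ℝ), Continuous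 a → TwoPoint G r a → Skewness G r a → GapInUnits G r a → FlatShape2 G r a ∧ FitWindow G r a) → (∀ (G : Type) [Group G] [TopologicalSpace G] [IsTopologicalGroup G] [CompactSpace G] [MeasurableSpace G] [BorelSpace G], IsCompactSimpleLieGroup G → ∀ (r : LatticeRep G) (a : ℝ → ℝ), Continuous a → TwoPoint G r a → Skewness G r a → GapInUnits G r a → FC3 G r a) → (open Literature.MathematicalPhysics.QuantumLattice Literature.MathematicalPhysics.AQFT Literature.MathematicalPhysics.QuantumFieldTheory Literature.Probability.LatticeModels in ∀ (G : Type) [Group G] [TopologicalSpace G] [IsTopologicalGroup G] [CompactSpace G], IsCompactSimpleLieGroup G → letI : MeasurableSpace G := borel G; haveI : BorelSpace G := ⟨rfl⟩; ∀ (r : LatticeRep G), ∀ (a : ℝ → ℝ), Continuous a → (∃ (Γ : ℝ → ℝ) (β₀ ℓ₀ c C : ℝ), 0 < ℓ₀ ∧ 0 < c ∧ (∀ β, 0 < a β) ∧ Filter.Tendsto a Filter.atTop (nhds 0) ∧ (∀ s : ℝ, 0 < s → s ≤ ℓ₀ → 0 < Γ s ∧ Γ s ≤ 1) ∧ ∀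 (L : ℕ) [NeZero L] (β : ℝ), β₀ ≤ β → (L : ℝ) * a β ≤ ℓ₀ → let P : (Fin 4 → ZMod L) → Fin 4 → Fin 4 → GaugeConfig 4 L G → ℝ := fun x i j U => (r.N : ℝ) - (r.ρ (plaquetteHolonomy U x i j)).trace.re; let E : (GaugeConfig 4 L G → ℝ) → ℝ := fun F => wilsonExpectation (d := 4) (L := L) r.ρ β F; let cov : (GaugeConfig 4 L G → ℝ) → (GaugeConfig 4 L G → ℝ) → ℝ := fun F F' => E (fun U => F U * F' U) - E F * E F'; let dist : (Fin 4 → ZMod L) → (Fin 4 → ZMod L) → ℝ := fun x y => Real.sqrt (∑ k : Fin 4, (((x k - y k).valMinAbs : ℤ) : ℝ) ^ 2); (∀ n : ℕ, 1 ≤ n → 8 * n ≤ L → c * Γ ((n : ℝ) * a β) ≤ (n : ℝ) ^ 8 * cov (P 0 0 1) (P (Pi.single (2 : Fin 4) ((n : ℕ) : ZMod L)) 0 1) ∧ (n : ℝ) ^ 8 * cov (P 0 0 1) (P (Pi.single (2 : Fin 4) ((n : ℕ) : ZMod L)) 0 1) ≤ C * Γ ((n : ℝ) * a β)) ∧ (∀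 (x y : Fin 4 → ZMod L) (i j i' j' : Fin 4), x ≠ y → i ≠ j → i' ≠ j' → |cov (P x i j) (P y i' j')| * dist x y ^ 8 ≤ C * Γ (dist x y * a β))) → (∃ (c₁ β₂ : ℝ) (S₁ : ℝ → ℕ), 0 < c₁ ∧ ∀ A B : YMSpecies G, ∃ C : ℝ, ∀ β : ℝ, β₂ ≤ β → ∀ S n : ℕ, S₁ β ≤ S → n ≤ S → |latticeConnectedCorr r.ρ β (2 * S + 1) A.F B.F n| ≤ C * Real.exp (-(c₁ * a β * n))) → (∃ (C β₄ ℓ₄ : ℝ), 0 < ℓ₄ ∧ 0 ≤ C ∧ ∀ β : ℝ, β₄ ≤ β → ∀ (L n : ℕ) (q : Fin n → Fin 4 × Fin 4) (x : Fin n → (Fin 4 → ℤ)) (R : ℕ), (∀ i, (q i).1 < (q i).2) → 1 ≤ R → (R : ℝ) * a β ≤ ℓ₄ → 4 * R + 8 ≤ L → (∀ i j : Fin n, i ≠ j → ∃ k : Fin 4, (2 * (R : ℤ) + 4) ≤ |((((x i k - x j k : ℤ) : ZMod (2 * L + 1))).valMinAbs : ℤ)|) → let E : (LGConfig 4 G →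 ℝ) → ℝ := fun F => ∫ U, F (torusLift (2 * L + 1) U) ∂(wilsonMeasure (d := 4) (L := 2 * L + 1) r.ρ β); let Pl : Fin 4 × Fin 4 → (Fin 4 → ℤ) → LGConfig 4 G → ℝ := fun p y U => plaquetteObs r.ρ 0 p.1 p.2 (configShift (-y) U); |E (fun U => ∏ i, (Pl (q i) (x i) U - E (Pl (q i) (x i))))| ≤ (C / (R : ℝ) ^ 4) ^ n) → ∀ (sch : SpeciesScheme (YMSpecies G)), (∀ k, sch.a k = a (sch.β k)) → Filter.Tendsto sch.β Filter.atTop Filter.atTop → (∀ k, 0 ≤ sch.β k ∧ sch.a k ≤ 1 / 24 ∧ 14 ≤ sch.L k ∧ (sch.a k)⁻¹ * (sch.a k)⁻¹ ≤ sch.L k) → ∃ r₀ : ℝ, 0 < r₀ ∧ ∀ (n : ℕ), 2 ≤ n → ∀ (F D : SchwartzMap (Fin n → EuclideanSpace ℝ (Fin 4)) ℂ), IsOffDiagonal F → HasCompactSupport (F : (Fin n → EuclideanSpace ℝ (Fin 4)) → ℂ) → (∃ δ : ℝ, 0 < δ ∧ tsupport (F : (Fin n → EuclideanSpace ℝ (Fin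 4)) → ℂ) ⊆ {x | ∀ i j, i ≠ j → δ ≤ dist (x i) (x j)}) → tsupport (F : (Fin n → EuclideanSpace ℝ (Fin 4)) → ℂ) ⊆ {x | ∀ i j, dist (x i) (x j) < r₀} → (∀ x, D x = fderiv ℝ (F : (Fin n → EuclideanSpace ℝ (Fin 4)) → ℂ) x (fun k => (x k 0) • (EuclideanSpace.single 1 1 : EuclideanSpace ℝ (Fin 4)) - (x k 1) • (EuclideanSpace.single 0 1 : EuclideanSpace ℝ (Fin 4)))) → Filter.Tendsto (fun k : ℕ => ∑ x ∈ Fintype.piFinset (fun _ : Fin n => box 4 (sch.L k)), (((∫ U, ∏ i, (r.curvature.F (configShift (-(x i)) (torusLift (2 * sch.L k + 1) U)) - ∫ V, r.curvature.F (torusLift (2 * sch.L k + 1) V) ∂(wilsonMeasure (d := 4) (L := 2 * sch.L k + 1) r.ρ (sch.β k))) ∂(wilsonMeasure (d := 4) (L := 2 * sch.L k + 1) r.ρ (sch.β k)) : ℝ) : ℂ) * D (fun i => sch.a k • siteToE (x i)))) Filter.atTop (nhds 0)) → OSLegsAtWeakCouplingC := by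
  intro hBL hGates hTame hK3 hE1
  refine osLegsAtWeakCouplingC_of_legs ?_ ?_ ?_
  · intro G _ _ _ _ hG
    letI : MeasurableSpace G := borel G
    haveI : BorelSpace G := ⟨rfl⟩
    intro r a ha h1 h2 h3
    exact uvHyperscalingC_of_boundaryLaw hBL G hG r a ha h1 h2 h3
  · intro G _ _ _ _ hG
    letI : MeasurableSpace G := borel G
    haveI : BorelSpace G := ⟨rfl⟩
    intro r a ha h1 h2 h3
    exact largeTorusNonTrivialityC_of_engine hBL hGates hTame hK3 G hG r a ha h1 h2 h3
  · intro G _ _ _ _ hG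
    letI : MeasurableSpace G := borel G
    haveI : BorelSpace G := ⟨rfl⟩
    intro r a ha h1 h3 h4
    exact latticeWard_of_latticeWardGermC_pointwise r a
      (hE1 G hG r a ha h1 h3 ((uvHyperscalingC_pointwise_iff r a).2 h4))

end Summit.QuantumFields.YangMills.Cruxes.OSLegsAtWeakCouplingC.InheritedAmplitudeGates

end
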